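import Summits.QuantumFields.BalabanUV.T4Continuum.Support.NE7OneStepOfExistence
import Summits.QuantumFields.BalabanUV.T4Continuum.Support.NE7ExistenceByInduction
import HarnessLib

/-!
# NE7OneStepOfInductiveStep — THE END OF RECORD OF GENERATION 88: ONE-STEP for all sufficiently small data ⇐ [Balaban1985Variational] Thm 1's
# INDUCTIVE STEP at a `P`-regular finer-critical background (Sects. A–G, displayed, ANY invariant `P`) ∧ `P` of the data ∧ row NE3's per-pair binder
# `hleaves²` ∧ two k-free lines — the a-priori estimate `hape` (F31 ∕ F33) and the bare existence `hexists` (F238) are GONE from the NE7 END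

Cell `pub-balaban`, rung (B)+1 sub-cell t4, lineage `b2b-balaban-t4-ne7-p1` (CRUX PROVER NE7 #1 = OWNER of row NE7), generation 88; memo
`t4/b2b-balaban-t4-ne7-p1-g88/EXISTENCE-BY-INDUCTION.md` §4.  File F241 (over F238 `NE7OneStepOfExistence`, F240 `NE7ExistenceByInduction`).

WHY.  F238: ONE-STEP ⇐ `hexists` ∧ `hleaves²` ∧ lines; F240: `hexists` ⇐ B11's inductive step STEP_P by induction on the level over all periods (F239's exact
datum refinement).  THIS FILE composes them: the NE7 END now consumes EXACTLY the inductive step of the printed proof — «from a `P`-regular configuration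
`U₀` on the level-`(j+1)` fibre of `D`, with the previous radius `δ₁∕(L^j)²` and tangent-critical for the finer constraint, produce an admissible
tangent-critical `U` with `SmallField U (δ₁∕(L^{j+1})²)` and `P` again» — the statement [B9]'s rows (Thm 3.1 ∕ 3.3, (3.49)) are made for, since they
hold at REGULAR backgrounds ((3.35)–(3.36)) and the induction is what supplies the regularity.
WHAT ([folklore] composition; 0 def, 0 sorry).
§1 **`oneStep_of_dataClass_step_routePi`** (generic `d`, `L ≥ 2`, every `N ≥ 1`): F238 §1 at `hexists := F240's hexists_of_step`; new numeric side conditions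
   `4(e^β − 1) ≤ δ₁` and `δ₁L² ≤ ε` (the refined datum's radius is the datum's; the previous level's good radius must fit the class one level up).
§2 **`oneStep_SU2_of_dataClass_step_routePi`** — `d = 4`, `L = 2`, `card n = 2`, `0 < ε ≤ 10⁻⁵³`, `4δ₁ ≤ ε`, `4(e^β−1) ≤ δ₁`: THE END OF RECORD of gen 88.
THE (A)-BILL AFTER THIS FILE: X-A4 ∧ **STEP_P** ∧ `P` of the data ∧ `hleaves²` on `𝒟_β` ∧ two k-free lines.  GONE: `hape` (Sect. F TYPE a-priori estimate),
`hexists`.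
HONEST FRAMING (page 1): composition over HYPOTHESES; STEP_P (B11 Sects. A–G TYPE), `P` of the data, row NE3's per-pair binder (B11 Prop. 2 ∕ (Π-REG-γ)
TYPE) and the numeric lines are asserted for nothing; `γ` inexplicit (F29's compactness); nothing of Bałaban's asserted; NOT ONE-STEP, NOT NE7; spine
0∕9; finite T⁴ rung (B)+1 — NOT infinite volume, NOT mass gap, NOT `BetaPertH`, NOT Clay.  Continuum YM on T⁴ ⇐ BetaPertH ∧ nine spine estimates (0/9
proved); BetaPertH ⇐ (D1) ∧ (D4) ∧ CAP+tail; G-an2-4 gates asym, D1 and NE2/3/4.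
-/

set_option autoImplicit false

open scoped BigOperators Matrix Matrix.Norms.L2Operator
open NormedSpace Finset Set

namespace Summit.QuantumFields.BalabanUV.T4Continuum.NE7OneStepOfInductiveStep

open Literature.MathematicalPhysics.QuantumFieldTheory.Balaban1983to89
open B7Prop1Explicit B7Prop2Explicit
open T4AveragingDeficitWall (IsUnitaryCfg IsSkewDir SmallField dirSq)
open T4AveragingDeficitWallBoundary (IsPeriodicCfg periodBox)
open AveragingDeficitPeriodicCounting (IsPeriodicDir)
open AveragingDeficitMultiLevelPrep (LevelSmall TangentIter)
open MinimalActionLevels (perWin)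
open MinimalActionSandwich (IsMinimiser admissible)
open MinimalActionRate (sfClass)
open NE3HessForm (dAction)
open NE3SlicePoincareShape (SlicePoincare)
open NE3SlicePoincareBudgetLine (CPLine)
open NE3FrameFreeSliceW (frameFreeBlockLandauW)
open NE3TangentCovariantTower (dirIter)
open NE3DecomposedRepOfLinearNormalPart (ResidualSliceRepT)
open NE3QbarIterCovLiftPrep (cruxC)
open NE3SmoothRightInverseW (rightInvW)
open NE3RightInverseSolveLetters (thetaLoc)
open NE3RightInverseL2Letter (l2C)
open NE3HatInvCurlLetters (curl2C curl1C)
open NE7OneStepOfExistence (oneStep_of_dataClass_exists_routePi oneStep_SU2_of_dataClass_exists_routePi)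
open NE7ExistenceByInduction (hexists_of_step)

noncomputable section

variable {d : ℕ} {n : Type*} [Fintype n] [DecidableEq n]

/-! ## §1 The END over the data class: B11's inductive step replaces existence -/

set_option maxHeartbeats 400000 in
-- statement-level budget (the `hrep` binder), as in F30 ∕ F31 ∕ F238
/-- **ONE-STEP FOR ALL SUFFICIENTLY SMALL DATA ⇐ B11's INDUCTIVE STEP (any invariant `P`) ∧ `P` OF THE DATA ∧ ROW NE3's `hleaves²` ON `𝒟_β`** (generic `d`,
`L ≥ 2`, every `N ≥ 1`): F238 §1 `oneStep_of_dataClass_exists_routePi` with `hexists` DISCHARGED by F240 `hexists_of_step`.  New side conditions: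
`4(e^β − 1) ≤ δ₁`, `δ₁L² ≤ ε`. [folklore] -/
theorem oneStep_of_dataClass_step_routePi [Nonempty n] {L N : ℕ} [NeZero L] [NeZero N] (hL : 2 ≤ L) (hN : 1 ≤ N) {ε δ δ₁ CP β : ℝ}
    (hε : 0 < ε) (hε1 : 16 * C0 d * ε ≤ 3) (hε2 : 1024 * (d + 1) * (d + 4) * (L : ℝ) ^ 2 * ε ≤ 1) (hδ₁ : 0 ≤ δ₁) (hδ₁δ : δ₁ < δ) (hδε : δ < ε)
    (hβδ₁ : 4 * (Real.exp β - 1) ≤ δ₁) (hδ₁L : δ₁ * (L : ℝ) ^ 2 ≤ ε)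
    (hCP : 0 < CP) (hβ : 0 < β) (hls : ∀ k : ℕ, LevelSmall d L k (ε / ((L : ℝ) ^ (k + 1)) ^ 2))
    (hP : ∀ (j : ℕ) (W' : Site d → Fin d → (Matrix n n ℂ)ˣ), W' ∈ sfClass d L N ε (j + 1) →
      SlicePoincare L (j + 1) W' (frameFreeBlockLandauW L N (j + 1) W') CP (periodBox (d := d) (N * L ^ (j + 1))))
    -- row NE3's right inverse regime (W6) and route Π's ceilings and two k-free lines
    (hθl : thetaLoc d L * ε < 1) (hε1' : ε ≤ 1) {C₂ αh Ch : ℝ} (hC₂ : 0 ≤ C₂) (hαh0 : 0 ≤ αh) (hαh1 : αh ≤ 1) (hCh0 : 0 ≤ Ch)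
    {νh κh : ℝ} (hνh : νh = 2 * Real.sqrt (l2C d L / (1 - thetaLoc d L * ε) ^ 2 + curl2C d L / (1 - thetaLoc d L * ε) ^ 2) * C₂ * Ch * αh)
    (hκh : κh = 4 * (curl1C d L / (1 - thetaLoc d L * ε)) * C₂ * Ch ^ 2 * ε) (hν : νh < 1)
    (hline : 2 * (κh / (1 - νh) ^ 2) < ((((1 / 2 - (νh / (1 - νh)) ^ 2) / (2 * (1 + CP)) - (νh / (1 - νh)) ^ 2) / 2
        - 576 * d * (αh ^ 2 * Real.exp (2 * αh))) / (Fintype.card n : ℝ) - 28 * d * (ε + 7 * αh ^ 2)))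
    -- the regularity invariant carried along B11's induction, holding for the data
    (P : ℕ → ℕ → (Site d → Fin d → (Matrix n n ℂ)ˣ) → Prop)
    (hP0 : ∀ (N' : ℕ) [NeZero N'] (D : Site d → Fin d → (Matrix n n ℂ)ˣ), IsUnitaryCfg D → IsPeriodicCfg D (N' : ℤ) →
      SmallField D (4 * (Real.exp β - 1)) → P N' 0 D)
    -- [B11] Thm 1's INDUCTIVE STEP (Sects. A–G) at a `P`-regular finer-critical background on the fibre (DISPLAYED)
    (hstep : ∀ (N' : ℕ) [NeZero N'] (j : ℕ) (D : Site d → Fin d → (Matrix n n ℂ)ˣ), IsUnitaryCfg D → IsPeriodicCfg D (N' : ℤ) →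
      SmallField D (4 * (Real.exp β - 1)) →
      ∀ U₀ ∈ admissible (sfClass d L N' ε) L (j + 1) D, SmallField U₀ (δ₁ / ((L : ℝ) ^ j) ^ 2) →
      (∀ k : ℕ, j = k + 1 → ∀ φ : Site d → Fin d → Matrix n n ℂ, IsSkewDir φ → IsPeriodicDir φ ((N' * L * L ^ (k + 1) : ℕ) : ℤ) →
        TangentIter L k U₀ φ → dAction U₀ φ (perWin d (N' * L * L ^ (k + 1))) = 0) →
      P (N' * L) j U₀ →
      ∃ U ∈ admissible (sfClass d L N' ε) L (j + 1) D, SmallField U (δ₁ / ((L : ℝ) ^ (j + 1)) ^ 2) ∧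
        (∀ φ : Site d → Fin d → Matrix n n ℂ, IsSkewDir φ → IsPeriodicDir φ ((N' * L ^ (j + 1) : ℕ) : ℤ) → TangentIter L j U φ →
          dAction U φ (perWin d (N' * L ^ (j + 1))) = 0) ∧
        P N' (j + 1) U)
    -- ROW NE3's PER-PAIR BINDER on the data class, at the pairs (U♯, U′), WITH THE FAR LOCAL QUADRATIC LETTER
    (hleaves2 : ∀ D : Site d → Fin d → (Matrix n n ℂ)ˣ, IsUnitaryCfg D → IsPeriodicCfg D (N : ℤ) → SmallField D (4 * (Real.exp β - 1)) →
      ∀ (k : ℕ), ∀ Us ∈ admissible (sfClass d L N ε) L (k + 1) D, SmallField Us (δ₁ / ((L : ℝ) ^ (k + 1)) ^ 2) →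
      (∀ φ : Site d → Fin d → Matrix n n ℂ, IsSkewDir φ → IsPeriodicDir φ ((N * L ^ (k + 1) : ℕ) : ℤ) → TangentIter L k Us φ →
        dAction Us φ (perWin d (N * L ^ (k + 1))) = 0) →
      ∀ U' ∈ admissible (sfClass d L N ε) L (k + 1) D,
      ∃ (u : Site d → (Matrix n n ℂ)ˣ) (X₀ : Site d → Fin d → Matrix n n ℂ) (α₀ : ℝ) (m : Site d → Fin d → ℝ) (C : ℝ),
        IsSkewDir X₀ ∧
        (∀ (hWu : IsUnitaryCfg Us) (hx : 0 ≤ ε / ((L : ℝ) ^ (k + 1)) ^ 2) (hs : LevelSmall d L k (ε / ((L : ℝ) ^ (k + 1)) ^ 2))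
            (hWx : SmallField Us (ε / ((L : ℝ) ^ (k + 1)) ^ 2))
            (hθ : cruxC d L * (((L : ℝ) ^ (k + 1)) ^ 2 * (ε / ((L : ℝ) ^ (k + 1)) ^ 2)) < 1)
            (hφ : IsSkewDir (dirIter L (k + 1) Us X₀)),
          ResidualSliceRepT L N (k + 1) Us U' u X₀ (rightInvW hL k hWu hx hs hWx N hθ hφ) α₀) ∧
        (∀ z κ, 0 ≤ m z κ) ∧ 0 ≤ C ∧
        ((L : ℝ) ^ (k + 1)) ^ d * ∑ z ∈ periodBox (d := d) N, ∑ κ : Fin d, m z κ ^ 2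
          ≤ C ^ 2 * dirSq X₀ (periodBox (d := d) (N * L ^ (k + 1))) ∧
        (∀ z ∈ periodBox (d := d) N, ∀ κ : Fin d, ‖dirIter L (k + 1) Us X₀ z κ‖ ≤ C₂ * ((L : ℝ) ^ (k + 1) * m z κ) ^ 2) ∧
        α₀ * (L : ℝ) ^ (k + 1) ≤ αh ∧ (∀ z κ, m z κ * (L : ℝ) ^ (k + 1) ≤ αh) ∧ C ≤ Ch ∧
        (∀ z ∈ periodBox (d := d) N, ∀ κ : Fin d, ‖dirIter L (k + 1) (gaugeAct u U') X₀ z κ‖ ≤ C₂ * ((L : ℝ) ^ (k + 1) * m z κ) ^ 2)) :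
    ∃ γ : ℝ, 0 < γ ∧ ∀ V : Site d → Fin d → (Matrix n n ℂ)ˣ, IsUnitaryCfg V → IsPeriodicCfg V (N : ℤ) → SmallField V γ →
      ∀ (k : ℕ) (U₀ : Site d → Fin d → (Matrix n n ℂ)ˣ), U₀ ∈ admissible (sfClass d L N ε) L (k + 1) V →
        SmallField U₀ (δ / ((L : ℝ) ^ k) ^ 2) →
        ∃ U, IsMinimiser d (sfClass d L N ε) L N (k + 1) V U ∧ SmallField U (δ / ((L : ℝ) ^ (k + 1)) ^ 2) := by
  have hβ0 : 0 ≤ 4 * (Real.exp β - 1) := by have := Real.add_one_le_exp β; nlinarith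
  have hβε : 4 * (Real.exp β - 1) ≤ ε := by linarith
  exact oneStep_of_dataClass_exists_routePi hL hN hε hε1 hε2 hδ₁ hδ₁δ hδε hCP hβ hls hP hθl hε1' hC₂ hαh0 hαh1 hCh0 hνh hκh hν hline
    (hexists_of_step (by omega) hβε hβδ₁ hβ0 hδ₁L P hP0 hstep N) hleaves2

/-! ## §2 `d = 4`, `L = 2`, SU(2): THE END OF RECORD of generation 88 -/

set_option maxHeartbeats 400000 in
-- statement-level budget (the `hrep` binder), as in F31 ∕ F33 ∕ F238
/-- **ONE-STEP AT `d = 4`, `L = 2`, SU(2)∕U(2) (`card n = 2`), `0 < ε ≤ 10⁻⁵³`, FOR ALL `γ`-SMALL DATA ⇐ [B11] Thm 1's INDUCTIVE STEP (any invariant `P`)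
∧ `P` OF THE DATA ∧ ROW NE3's `hleaves²` ON `𝒟_β`** ((P♮)_W, the level family, the class smallness, `ε ≤ 1` and the W6 regime DISCHARGED as in F33 ∕
F238; displayed uniformly: the ceilings `C₂, α̂, Ĉ`, the two k-free lines, and the side conditions `4(e^β−1) ≤ δ₁`, `4δ₁ ≤ ε`).  THE END OF RECORD of
generation 88. [folklore] -/
theorem oneStep_SU2_of_dataClass_step_routePi [Nonempty n] (hn : Fintype.card n = 2) {N : ℕ} [NeZero N] (hN : 1 ≤ N) {ε δ δ₁ β : ℝ}
    (hε : 0 < ε) (hε' : ε ≤ 1 / 10 ^ 53) (hδ₁ : 0 ≤ δ₁) (hδ₁δ : δ₁ < δ) (hδε : δ < ε) (hβ : 0 < β)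
    (hβδ₁ : 4 * (Real.exp β - 1) ≤ δ₁) (hδ₁4 : 4 * δ₁ ≤ ε)
    {C₂ αh Ch : ℝ} (hC₂ : 0 ≤ C₂) (hαh0 : 0 ≤ αh) (hαh1 : αh ≤ 1) (hCh0 : 0 ≤ Ch)
    {νh κh : ℝ} (hνh : νh = 2 * Real.sqrt (l2C 4 2 / (1 - thetaLoc 4 2 * ε) ^ 2 + curl2C 4 2 / (1 - thetaLoc 4 2 * ε) ^ 2) * C₂ * Ch * αh)
    (hκh : κh = 4 * (curl1C 4 2 / (1 - thetaLoc 4 2 * ε)) * C₂ * Ch ^ 2 * ε) (hν : νh < 1)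
    (hline : 2 * (κh / (1 - νh) ^ 2) < ((((1 / 2 - (νh / (1 - νh)) ^ 2) / (2 * (1 + (CPLine 4 2 2 (1 / 10 ^ 17) (1 / 10 ^ 53) + 1)))
        - (νh / (1 - νh)) ^ 2) / 2 - 576 * (4 : ℕ) * (αh ^ 2 * Real.exp (2 * αh))) / (Fintype.card n : ℝ) - 28 * (4 : ℕ) * (ε + 7 * αh ^ 2)))
    (P : ℕ → ℕ → (Site 4 → Fin 4 → (Matrix n n ℂ)ˣ) → Prop)
    (hP0 : ∀ (N' : ℕ) [NeZero N'] (D : Site 4 → Fin 4 → (Matrix n n ℂ)ˣ), IsUnitaryCfg D → IsPeriodicCfg D (N' : ℤ) →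
      SmallField D (4 * (Real.exp β - 1)) → P N' 0 D)
    (hstep : ∀ (N' : ℕ) [NeZero N'] (j : ℕ) (D : Site 4 → Fin 4 → (Matrix n n ℂ)ˣ), IsUnitaryCfg D → IsPeriodicCfg D (N' : ℤ) →
      SmallField D (4 * (Real.exp β - 1)) →
      ∀ U₀ ∈ admissible (sfClass 4 2 N' ε) 2 (j + 1) D, SmallField U₀ (δ₁ / ((((2 : ℕ) : ℝ)) ^ j) ^ 2) →
      (∀ k : ℕ, j = k + 1 → ∀ φ : Site 4 → Fin 4 → Matrix n n ℂ, IsSkewDir φ → IsPeriodicDir φ ((N' * 2 * 2 ^ (k + 1) : ℕ) : ℤ) →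
        TangentIter 2 k U₀ φ → dAction U₀ φ (perWin 4 (N' * 2 * 2 ^ (k + 1))) = 0) →
      P (N' * 2) j U₀ →
      ∃ U ∈ admissible (sfClass 4 2 N' ε) 2 (j + 1) D, SmallField U (δ₁ / ((((2 : ℕ) : ℝ)) ^ (j + 1)) ^ 2) ∧
        (∀ φ : Site 4 → Fin 4 → Matrix n n ℂ, IsSkewDir φ → IsPeriodicDir φ ((N' * 2 ^ (j + 1) : ℕ) : ℤ) → TangentIter 2 j U φ →
          dAction U φ (perWin 4 (N' * 2 ^ (j + 1))) = 0) ∧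
        P N' (j + 1) U)
    (hleaves2 : ∀ D : Site 4 → Fin 4 → (Matrix n n ℂ)ˣ, IsUnitaryCfg D → IsPeriodicCfg D (N : ℤ) → SmallField D (4 * (Real.exp β - 1)) →
      ∀ (k : ℕ), ∀ Us ∈ admissible (sfClass 4 2 N ε) 2 (k + 1) D, SmallField Us (δ₁ / ((((2 : ℕ) : ℝ)) ^ (k + 1)) ^ 2) →
      (∀ φ : Site 4 → Fin 4 → Matrix n n ℂ, IsSkewDir φ → IsPeriodicDir φ ((N * 2 ^ (k + 1) : ℕ) : ℤ) → TangentIter 2 k Us φ →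
        dAction Us φ (perWin 4 (N * 2 ^ (k + 1))) = 0) →
      ∀ U' ∈ admissible (sfClass 4 2 N ε) 2 (k + 1) D,
      ∃ (u : Site 4 → (Matrix n n ℂ)ˣ) (X₀ : Site 4 → Fin 4 → Matrix n n ℂ) (α₀ : ℝ) (m : Site 4 → Fin 4 → ℝ) (C : ℝ),
        IsSkewDir X₀ ∧
        (∀ (hWu : IsUnitaryCfg Us) (hx : 0 ≤ ε / ((((2 : ℕ) : ℝ)) ^ (k + 1)) ^ 2)
            (hs : LevelSmall 4 2 k (ε / ((((2 : ℕ) : ℝ)) ^ (k + 1)) ^ 2)) (hWx : SmallField Us (ε / ((((2 : ℕ) : ℝ)) ^ (k + 1)) ^ 2))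
            (hθ : cruxC 4 2 * (((((2 : ℕ) : ℝ)) ^ (k + 1)) ^ 2 * (ε / ((((2 : ℕ) : ℝ)) ^ (k + 1)) ^ 2)) < 1)
            (hφ : IsSkewDir (dirIter 2 (k + 1) Us X₀)),
          ResidualSliceRepT 2 N (k + 1) Us U' u X₀ (rightInvW (by norm_num) k hWu hx hs hWx N hθ hφ) α₀) ∧
        (∀ z κ, 0 ≤ m z κ) ∧ 0 ≤ C ∧
        ((((2 : ℕ) : ℝ)) ^ (k + 1)) ^ 4 * ∑ z ∈ periodBox (d := 4) N, ∑ κ : Fin 4, m z κ ^ 2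
          ≤ C ^ 2 * dirSq X₀ (periodBox (d := 4) (N * 2 ^ (k + 1))) ∧
        (∀ z ∈ periodBox (d := 4) N, ∀ κ : Fin 4, ‖dirIter 2 (k + 1) Us X₀ z κ‖ ≤ C₂ * ((((2 : ℕ) : ℝ)) ^ (k + 1) * m z κ) ^ 2) ∧
        α₀ * (((2 : ℕ) : ℝ)) ^ (k + 1) ≤ αh ∧ (∀ z κ, m z κ * (((2 : ℕ) : ℝ)) ^ (k + 1) ≤ αh) ∧ C ≤ Ch ∧
        (∀ z ∈ periodBox (d := 4) N, ∀ κ : Fin 4,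
          ‖dirIter 2 (k + 1) (gaugeAct u U') X₀ z κ‖ ≤ C₂ * ((((2 : ℕ) : ℝ)) ^ (k + 1) * m z κ) ^ 2)) :
    ∃ γ : ℝ, 0 < γ ∧ ∀ V : Site 4 → Fin 4 → (Matrix n n ℂ)ˣ, IsUnitaryCfg V → IsPeriodicCfg V (N : ℤ) → SmallField V γ →
      ∀ (k : ℕ) (U₀ : Site 4 → Fin 4 → (Matrix n n ℂ)ˣ), U₀ ∈ admissible (sfClass 4 2 N ε) 2 (k + 1) V →
        SmallField U₀ (δ / ((((2 : ℕ) : ℝ)) ^ k) ^ 2) →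
        ∃ U, IsMinimiser 4 (sfClass 4 2 N ε) 2 N (k + 1) V U ∧ SmallField U (δ / ((((2 : ℕ) : ℝ)) ^ (k + 1)) ^ 2) := by
  have hβ0 : 0 ≤ 4 * (Real.exp β - 1) := by have := Real.add_one_le_exp β; nlinarith
  have hβε : 4 * (Real.exp β - 1) ≤ ε := by linarith
  have hδ₁L : δ₁ * (((2 : ℕ) : ℝ)) ^ 2 ≤ ε := by norm_num; linarith
  exact oneStep_SU2_of_dataClass_exists_routePi hn hN hε hε' hδ₁ hδ₁δ hδε hβ hC₂ hαh0 hαh1 hCh0 hνh hκh hν hline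
    (hexists_of_step (L := 2) (by norm_num) hβε hβδ₁ hβ0 hδ₁L P hP0 hstep N) hleaves2

end

end Summit.QuantumFields.BalabanUV.T4Continuum.NE7OneStepOfInductiveStep
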